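import Summits.RiemannHypothesis.RiemannHypothesis.Theorems.GroundBartaEvenWinsBeyondArchDeflationM106Common
import HarnessLib

/-!
# RiemannHypothesis / GroundBarta — parity ladder beyond `(log 8)/2` (`EvenWinsBeyondArch`, stmt-RiemannHypothesis-18085):
# shared facts of the A-layer at the window `b = 109 / 100` (right end of parity cell 17 = (27/25, 109/100] (prover B g22 one-run O109, μ 2^-113), left end of a possible last cell 18 (the six-prime kit ends before (log 9)/2 = 1.0986))

Helper file (`--supports stmt-RiemannHypothesis-18085`), RH-free, no named facts, no definitions.  Prover A (gen 25 of unit `sr-gb-rung-a`),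
after the per-cell `…Common` template (`…M1035Common`, `…M106Common`).

The window `b = 109 / 100 = 1.09` lies in the six-prime-power regime `(log 8)/2 < 109 / 100 ≤ (log 9)/2` (`m109_log8half_lt`: `log 8 = 3 log 2 <
2.0795`; `m109_le_log9half`: `log 9 = 2 log 3 > 2.1972`), prime powers `2, 3, 4, 5, 7, 8` visible.  Only the window-dependent order facts
live here; the sharp six-prime prime check of the finals at this window is the window-INDEPENDENT `m106_prime8CheckSharp` of `…M106Common`
(imported; restating it would be a duplicate), the pole check lives in each final, the killing-constant bracket is `dt_f8_weilMarkovConstant_sharp6`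
(`…DeflationMarkovY8`).
-/

set_option linter.dupNamespace false

noncomputable section

namespace Summit.RiemannHypothesis.RiemannHypothesis.Theorems.EvenWinsBeyondArch

open Literature.NumberTheory.LFunctions Finset

/-- `(log 8)/2 < 109 / 100` (`log 8 = 3 log 2 = 2.0794…`). [folklore] -/
theorem m109_log8half_lt : Real.log 8 / 2 < (((109 / 100 : ℚ)) : ℝ) := by
  have h := Real.log_two_lt_d9
  have h8 : Real.log 8 = 3 * Real.log 2 := by
    rw [show (8 : ℝ) = 2 ^ 3 by norm_num, Real.log_pow]; push_cast; ring
  push_cast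
  rw [h8]
  linarith

/-- `109 / 100 ≤ (log 9)/2` (`log 9 = 2 log 3 = 2.1972…`). [folklore] -/
theorem m109_le_log9half : (((109 / 100 : ℚ)) : ℝ) ≤ Real.log 9 / 2 := by
  have h := Real.log_three_gt_d9
  have h9 : Real.log 9 = 2 * Real.log 3 := by
    rw [show (9 : ℝ) = 3 ^ 2 by norm_num, Real.log_pow]; push_cast; ring
  push_cast
  rw [h9]
  linarith

/-- `27 / 25 ≤ 109 / 100` as real casts of the rational windows (antitone transport of the cell-17 U-side). [folklore] -/
theorem m109_ge_108 : (((27 / 25 : ℚ)) : ℝ) ≤ (((109 / 100 : ℚ)) : ℝ) := by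
  push_cast; norm_num

/-- `0 < 109 / 100` for the rational window cast. [folklore] -/
theorem m109_pos : (0 : ℝ) < (((109 / 100 : ℚ)) : ℝ) := by
  push_cast; norm_num

end Summit.RiemannHypothesis.RiemannHypothesis.Theorems.EvenWinsBeyondArch

end
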